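import Summits.HodgeConjecture.HodgeConjecture.Theorems.F0LD1CharThetaSpaceLeOfIrreducible
import HarnessLib

-- As in the lineage: statements over the theta-kernel datum elaborate to very large types; elaborate sequentially.
set_option Elab.async false

/-!
# Crux `HLiu418`, organ (R) `ThetaRealisation₂` (= LD2 A₂) — THE JUNCTION WITHOUT MULTIPLICITY ONE: «the theta space of the line `⟨a⟩` is NOT ORTHOGONAL
# to `P`» ⟹ «`P` MEETS the theta lift from `⟨a⟩`», by irreducibility of the character theta span (I′) AND THE REALISATION IDENTITY [Liu2021, Cor. B.6 (1)]

Cell hodgecm-mathlib (D-0151), FLOOR 0; crux item `HLiu418` = stmt-HodgeConjecture-24832; organ (R) of line LD1 (`Lines/F0_P6LD_StubS1FactsThetaRoad.lean`)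
= organ A₂ of line LD2.  Seat LD1-p01 (g0), amicus edition 2026-09-02 to the LD1-plan honesty flag: the ★ junction (A₂-J)
`F0LD2MeetsOfNonOrthogonal.meetsThetaLiftFromLine_of_starProjection_ne_zero` (LD2-p02 (g0), p849185) consumed MULTIPLICITY ONE (`hM1`, in the closer ★ p849272
fed by the letter `Rogawski1990.curveMultiplicityLeOne`, which ALONE pays socket #73); this file is the SAME junction with `hM1` REPLACED by the realisation
identity of [Liu2021, Cor. B.6 (1), second clause] = [Wu2013, Thm. 5.1] («`V_π = Θ^V(Θ^W(V_π))`»), taken BY VALUE as the hypothesis `hReal` = the body of the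
statement-only row `Liu2021.ThetaLiftFromLineRealises` (LD1-p01 draft, sibling of ★ `Liu2021.ThetaLiftFromLineIrreducible`) quantified over the characters `ξ`:
«if `pr_P` does not kill every `(a, ξ)`-theta class then the carrier of `P` lies in their closed span».  THEOREMS ONLY (no `def`, no instance, no notation, no
named fact, no `sorry`); `--supports stmt-HodgeConjecture-24832`.  HC_CM is proved only modulo the 7 printed citations (2 remaining: hLiu418 =
stmt-HodgeConjecture-24832, h413 = stmt-HodgeConjecture-24833) until rung 0 closes; this file discharges nothing printed — it shows that organ (R) needs NO
multiplicity statement: print's own route ([Liu2021, Cor. B.6 (3)]: `m_cusp(π) = 1` FROM B.6 (1) + Thm. B.4, not from Arthur's formula).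

THE PROOF.  STEP 1–2 verbatim from (A₂-J): the projection `pr_P` of a theta class `[Θ̃_Φ(f) ∘ ιA]` is non-zero ⇒ (character decomposition, ★ kit
`exists_charCM_of_apply_toLp_lineThetaLift_ne_zero`) so is `pr_P v` for the class `v` of some CHARACTER `ξ`; the closed `(a, ξ)`-theta span is the carrier of a
closed invariant `Q ∋ v` (★ `exists_closedSubrep_thetaSpan`), irreducible by `hIrr` (`v ≠ 0`).  STEP 3 (new, ten lines): `hReal ξ P ⟨witnesses, pr_P v ≠ 0⟩`
gives `P ⊆ Q̄ = Q`; `P` is a non-zero closed invariant subspace of the irreducible `Q`, so `P = Q` (★ `ClosedSubrep.eq_of_le_of_isTopIrreducible`), whence the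
non-zero theta class `v ∈ P`: ★ `MeetsThetaLiftFromLine`.

HONEST SCOPE.  Nothing deep is proved here; the depth is in the two letters `hIrr` ([Wu2013, Thm. 5.3]) and `hReal` ([Wu2013, Thm. 5.1]: Rallis' inner
product formula in operator form + regularized Siegel–Weil).  Junk: every hypothesis is consumed; with `hReal` dropped the statement is false whenever the
near-equivalence class of the theta lift had a second discrete realisation (the diagonal copy), which is exactly what [Wu2013, Thm. 5.1] excludes.

## References
* [Liu2021] Y. Liu, Camb. J. Math. 9 (2021) = arXiv:2102.11518: App. B Cor. B.6 (1), (3) and their proofs (p. 99); proof of Prop. 4.13 Case 1 (p. 48);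
  App. D proof of Prop. D.4 (1) (p. 130–131).
* [Wu2013] C. Wu, *Irreducibility of theta lifting for unitary groups*, J. Number Theory 133 (2013), Thm. 5.1, Thm. 5.3.
* [Rallis1984] S. Rallis, *On the Howe duality conjecture*, Compositio Math. 51 (1984), §1.  [DeitmarEchterhoff2014] Cor. 6.1.9.
-/

set_option autoImplicit false
-- the mandated namespace has the single-problem summit's repeated segment (`HodgeConjecture.HodgeConjecture`)
set_option linter.dupNamespace false

noncomputable section

open NumberField NumberField.InfinitePlace MeasureTheory IsDedekindDomain
open scoped Matrix ComplexOrder ENNReal Classical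

namespace Summit.HodgeConjecture.HodgeConjecture.Cruxes.HLiu418.F0LD1MeetsOfRealises

open _root_.MeasureTheory
open Literature.NumberTheory.Automorphic Literature.NumberTheory.Automorphic.UnitaryGroup
open Literature.NumberTheory.Automorphic.UnitaryGroup.CotangentForms
open Literature.NumberTheory.Automorphic.IdeleClassGroup
open Literature.NumberTheory.Automorphic.Liu2021
open Literature.NumberTheory.Automorphic.Liu2021.Def411WeilCarriers
open Literature.NumberTheory.Automorphic.Liu2021.Def411WeilCarriersDoubling
open Literature.NumberTheory.GelbartRogawski1991 Literature.NumberTheory.GelbartRogawski1991.UnitaryDualPair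
open Literature.NumberTheory.Weil1964
open Literature.RepresentationTheory.Liu2021
open Literature.RepresentationTheory.CompactGroups
open Summit.HodgeConjecture.HodgeConjecture.Cruxes.HLiu418.F0LD1ThetaTransportKit
open Summit.HodgeConjecture.HodgeConjecture.Cruxes.HLiu418.F0LD2FrameTransportPin
open Summit.HodgeConjecture.HodgeConjecture.Cruxes.HLiu418.F0LD1CharThetaSpaceLeOfIrreducible

variable (L : Type) [Field L] [NumberField L] [IsCMField L] (N : ℕ) (H : Matrix (Fin N) (Fin N) L)
  {n' : ℕ} (e₁ : Fin N × Fin 1 ≃ Fin n') (dV : Fin N → L) (hdV : ∀ i, IsCMField.complexConj L (dV i) = dV i)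
  (hdV0 : ∀ i, dV i ≠ 0) (t : L) (ht : t ≠ 0) (g : GL (Fin N) L)
  (hg : formCongr ((IsCMField.complexConj L : L ≃ₐ[(↥(maximalRealSubfield L))] L) : L →+* L) g (t • H) = Matrix.diagonal dV)
  (ιA : (adelicGroupData (↥(maximalRealSubfield L)) L (IsCMField.complexConj L) N H).Adelic →*
    ↥(UnitaryGroup.adelic (↥(maximalRealSubfield L)) L (IsCMField.complexConj L) N (Matrix.diagonal dV)))
  (hιA : ∀ k, ((ιA k : ↥(UnitaryGroup.adelic (↥(maximalRealSubfield L)) L (IsCMField.complexConj L) N (Matrix.diagonal dV))) :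
      GL (Fin N) (AdeleRing (𝓞 L) L)) =
    (toAdeleGL L g)⁻¹ * adelicVal (↥(maximalRealSubfield L)) L (IsCMField.complexConj L) N H k * toAdeleGL L g)
  [CompactSpace (↥(UnitaryGroup.adelic (↥(maximalRealSubfield L)) L (IsCMField.complexConj L) N (Matrix.diagonal dV)) ⧸
    (UnitaryGroup.toAdelic (↥(maximalRealSubfield L)) L (IsCMField.complexConj L) N (Matrix.diagonal dV)).range)]
  {μA : Measure (adelicGroupData (↥(maximalRealSubfield L)) L (IsCMField.complexConj L) N H).automorphicQuotient}
  [(adelicGroupData (↥(maximalRealSubfield L)) L (IsCMField.complexConj L) N H).IsAutomorphicMeasure μA]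
  [CompactSpace (adelicGroupData (↥(maximalRealSubfield L)) L (IsCMField.complexConj L) N H).automorphicQuotient]

include ht hg hιA

-- EDITION 2 (buildfix custody N1, director g26 2026-09-02T05:25:07Z): the statement header alone (three `letI`-prefixed binder telescopes
-- `hIrr`∕`hReal`∕`hpr`) measures ≈ 105k heartbeats, the whole declaration ≈ 147k after LA6-p02 (g2)'s two proof-only trims (`let v`, `haveI := hinvW`);
-- the lane's kit line below gives the 2.7× margin.  Statement and conclusion byte-identical to EDITION 1 (p849430).
set_option maxHeartbeats 400000 in
/-- **(R-J′) NON-ORTHOGONALITY ⟹ MEETS, WITHOUT MULTIPLICITY ONE.**  In the scaled rational frame `formCongr c g (t • H) = diag dV` with the pinned transport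
`ιA` (`↑(ιA k) = g_𝔸⁻¹ k g_𝔸`), let `P` be a discrete automorphic representation of `U(H)` and `⟨a⟩` a hermitian line with the `μ`-splitting.  Assume:
`hIrr` — for every character `ξ` of `[U(⟨a⟩)]` the closed `(a, ξ)`-theta span is `0` or topologically irreducible (body of ★ `Liu2021.ThetaLiftFromLineIrreducible`,
[Liu2021, Cor. B.6 (1) first clause] = [Wu2013, Thm. 5.3]); `hReal` — for every `ξ` and every discrete automorphic `P′`, if `pr_{P′}` of some `(a, ξ)`-theta
class is non-zero then the carrier of `P′` lies in the closed `(a, ξ)`-theta span (body of the row `Liu2021.ThetaLiftFromLineRealises`, [Liu2021, Cor. B.6 (1)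
second clause] = [Wu2013, Thm. 5.1]); `hpr` — the projection to `P` of SOME theta class `[Θ̃_Φ(f) ∘ ιA]` is non-zero ([Liu2021, Thm. B.4 (1) (c)]).  THEN `P`
MEETS the theta lift from `⟨a⟩` along `ιA` (★ `MeetsThetaLiftFromLine`).  No multiplicity-one hypothesis.
[cite: Liu2021, App. B Cor. B.6 (1), (3) and proofs (p. 99); proof of Prop. 4.13 Case 1 (p. 48)] [cite: Wu2013, Thm. 5.1, Thm. 5.3]
[cite: DeitmarEchterhoff2014, Cor. 6.1.9] -/
theorem meetsThetaLiftFromLine_of_realises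
    (P : DiscreteAutomorphicRep (adelicGroupData (↥(maximalRealSubfield L)) L (IsCMField.complexConj L) N H) μA)
    (μ : Literature.NumberTheory.Automorphic.IdeleClassGroup L →ₜ* Circle) (hμ : IsConjugateSymplectic L μ) (a : (↥(maximalRealSubfield L))ˣ)
    (hIrr : letI : MeasurableSpace (↥(UnitaryGroup.adelic (↥(maximalRealSubfield L)) L (IsCMField.complexConj L) 1 (JW (↥(maximalRealSubfield L)) L a)) ⧸
        (UnitaryGroup.toAdelic (↥(maximalRealSubfield L)) L (IsCMField.complexConj L) 1 (JW (↥(maximalRealSubfield L)) L a)).range) := borel _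
      haveI := normal_range_toAdelic_JW L a
      ∀ (ξ : PontryaginDual (↥(UnitaryGroup.adelic (↥(maximalRealSubfield L)) L (IsCMField.complexConj L) 1 (JW (↥(maximalRealSubfield L)) L a)) ⧸
          (UnitaryGroup.toAdelic (↥(maximalRealSubfield L)) L (IsCMField.complexConj L) 1 (JW (↥(maximalRealSubfield L)) L a)).range))
        (Q : ContRepresentation.ClosedSubrep ((adelicGroupData (↥(maximalRealSubfield L)) L (IsCMField.complexConj L) N H).rightRegular μA)),
        (Q.toSubmodule : Set ((adelicGroupData (↥(maximalRealSubfield L)) L (IsCMField.complexConj L) N H).L2 μA)) = closure (Submodule.span ℂ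
            {v : (adelicGroupData (↥(maximalRealSubfield L)) L (IsCMField.complexConj L) N H).L2 μA | ∃ (hρ : HasThetaMajorants fun
          (p : ↥(UnitaryGroup.adelic (↥(maximalRealSubfield L)) L (IsCMField.complexConj L) N (Matrix.diagonal dV)) × ↥(UnitaryGroup.adelic (↥(maximalRealSubfield L)) L (IsCMField.complexConj L) 1 (JW (↥(maximalRealSubfield L)) L a))) (Φ : piSchwartzBruhat (↥(maximalRealSubfield L)) (Fin n')) =>
            pairRep (↥(maximalRealSubfield L)) L (IsCMField.complexConj L) N 1 e₁ (Matrix.diagonal dV) (JW (↥(maximalRealSubfield L)) L a)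
              (chiSplittingLine L e₁ dV hdV hdV0 (toHeckeCharacter L μ) (isUnitary_toHeckeCharacter L μ)
                ((isOscillatorChar_toHeckeCharacter_iff μ).mpr hμ) (TW (↥(maximalRealSubfield L)) a)
                (isUnit_det_TW (↥(maximalRealSubfield L)) a) (JW (↥(maximalRealSubfield L)) L a) (JW_eq (↥(maximalRealSubfield L)) L a))
              p Φ)
            (μW : Measure (↥(UnitaryGroup.adelic (↥(maximalRealSubfield L)) L (IsCMField.complexConj L) 1 (JW (↥(maximalRealSubfield L)) L a)) ⧸ (UnitaryGroup.toAdelic (↥(maximalRealSubfield L)) L (IsCMField.complexConj L) 1 (JW (↥(maximalRealSubfield L)) L a)).range)) (_ : IsFiniteMeasure μW)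
            (_ : SMulInvariantMeasure ↥(UnitaryGroup.adelic (↥(maximalRealSubfield L)) L (IsCMField.complexConj L) 1 (JW (↥(maximalRealSubfield L)) L a)) (↥(UnitaryGroup.adelic (↥(maximalRealSubfield L)) L (IsCMField.complexConj L) 1 (JW (↥(maximalRealSubfield L)) L a)) ⧸ (UnitaryGroup.toAdelic (↥(maximalRealSubfield L)) L (IsCMField.complexConj L) 1 (JW (↥(maximalRealSubfield L)) L a)).range) μW)
            (Ψ : piSchwartzBruhat (↥(maximalRealSubfield L)) (Fin n'))
            (hθ : MemLp (toQuotFun (adelicGroupData (↥(maximalRealSubfield L)) L (IsCMField.complexConj L) N H) fun x =>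
              (lineThetaKernelDatum L N e₁ dV hdV hdV0 μ hμ a hρ).thetaLiftFun μW Ψ (charCM ξ) (ιA x)) 2 μA),
            v = MemLp.toLp _ hθ} : Set ((adelicGroupData (↥(maximalRealSubfield L)) L (IsCMField.complexConj L) N H).L2 μA)) →
        Q.toSubmodule = ⊥ ∨ Q.toContRep.IsTopIrreducible)
    (hReal : letI : MeasurableSpace (↥(UnitaryGroup.adelic (↥(maximalRealSubfield L)) L (IsCMField.complexConj L) 1 (JW (↥(maximalRealSubfield L)) L a)) ⧸
        (UnitaryGroup.toAdelic (↥(maximalRealSubfield L)) L (IsCMField.complexConj L) 1 (JW (↥(maximalRealSubfield L)) L a)).range) := borel _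
      haveI := normal_range_toAdelic_JW L a
      ∀ (ξ : PontryaginDual (↥(UnitaryGroup.adelic (↥(maximalRealSubfield L)) L (IsCMField.complexConj L) 1 (JW (↥(maximalRealSubfield L)) L a)) ⧸
          (UnitaryGroup.toAdelic (↥(maximalRealSubfield L)) L (IsCMField.complexConj L) 1 (JW (↥(maximalRealSubfield L)) L a)).range)),
      ∀ P : DiscreteAutomorphicRep (adelicGroupData (↥(maximalRealSubfield L)) L (IsCMField.complexConj L) N H) μA,
        (∃ (hρ : HasThetaMajorants fun
          (p : ↥(UnitaryGroup.adelic (↥(maximalRealSubfield L)) L (IsCMField.complexConj L) N (Matrix.diagonal dV)) × ↥(UnitaryGroup.adelic (↥(maximalRealSubfield L)) L (IsCMField.complexConj L) 1 (JW (↥(maximalRealSubfield L)) L a))) (Φ : piSchwartzBruhat (↥(maximalRealSubfield L)) (Fin n')) =>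
            pairRep (↥(maximalRealSubfield L)) L (IsCMField.complexConj L) N 1 e₁ (Matrix.diagonal dV) (JW (↥(maximalRealSubfield L)) L a)
              (chiSplittingLine L e₁ dV hdV hdV0 (toHeckeCharacter L μ) (isUnitary_toHeckeCharacter L μ)
                ((isOscillatorChar_toHeckeCharacter_iff μ).mpr hμ) (TW (↥(maximalRealSubfield L)) a)
                (isUnit_det_TW (↥(maximalRealSubfield L)) a) (JW (↥(maximalRealSubfield L)) L a) (JW_eq (↥(maximalRealSubfield L)) L a))
              p Φ)
            (μW : Measure (↥(UnitaryGroup.adelic (↥(maximalRealSubfield L)) L (IsCMField.complexConj L) 1 (JW (↥(maximalRealSubfield L)) L a)) ⧸ (UnitaryGroup.toAdelic (↥(maximalRealSubfield L)) L (IsCMField.complexConj L) 1 (JW (↥(maximalRealSubfield L)) L a)).range)) (_ : IsFiniteMeasure μW)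
            (_ : SMulInvariantMeasure ↥(UnitaryGroup.adelic (↥(maximalRealSubfield L)) L (IsCMField.complexConj L) 1 (JW (↥(maximalRealSubfield L)) L a)) (↥(UnitaryGroup.adelic (↥(maximalRealSubfield L)) L (IsCMField.complexConj L) 1 (JW (↥(maximalRealSubfield L)) L a)) ⧸ (UnitaryGroup.toAdelic (↥(maximalRealSubfield L)) L (IsCMField.complexConj L) 1 (JW (↥(maximalRealSubfield L)) L a)).range) μW)
            (Ψ : piSchwartzBruhat (↥(maximalRealSubfield L)) (Fin n'))
            (hθ : MemLp (toQuotFun (adelicGroupData (↥(maximalRealSubfield L)) L (IsCMField.complexConj L) N H) fun x =>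
              (lineThetaKernelDatum L N e₁ dV hdV hdV0 μ hμ a hρ).thetaLiftFun μW Ψ (charCM ξ) (ιA x)) 2 μA),
            P.space.toSubmodule.starProjection (MemLp.toLp _ hθ) ≠ 0) →
        (P.space.toSubmodule : Set ((adelicGroupData (↥(maximalRealSubfield L)) L (IsCMField.complexConj L) N H).L2 μA)) ⊆ closure (Submodule.span ℂ
            {v : (adelicGroupData (↥(maximalRealSubfield L)) L (IsCMField.complexConj L) N H).L2 μA | ∃ (hρ : HasThetaMajorants fun
          (p : ↥(UnitaryGroup.adelic (↥(maximalRealSubfield L)) L (IsCMField.complexConj L) N (Matrix.diagonal dV)) × ↥(UnitaryGroup.adelic (↥(maximalRealSubfield L)) L (IsCMField.complexConj L) 1 (JW (↥(maximalRealSubfield L)) L a))) (Φ : piSchwartzBruhat (↥(maximalRealSubfield L)) (Fin n')) =>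
            pairRep (↥(maximalRealSubfield L)) L (IsCMField.complexConj L) N 1 e₁ (Matrix.diagonal dV) (JW (↥(maximalRealSubfield L)) L a)
              (chiSplittingLine L e₁ dV hdV hdV0 (toHeckeCharacter L μ) (isUnitary_toHeckeCharacter L μ)
                ((isOscillatorChar_toHeckeCharacter_iff μ).mpr hμ) (TW (↥(maximalRealSubfield L)) a)
                (isUnit_det_TW (↥(maximalRealSubfield L)) a) (JW (↥(maximalRealSubfield L)) L a) (JW_eq (↥(maximalRealSubfield L)) L a))
              p Φ)
            (μW : Measure (↥(UnitaryGroup.adelic (↥(maximalRealSubfield L)) L (IsCMField.complexConj L) 1 (JW (↥(maximalRealSubfield L)) L a)) ⧸ (UnitaryGroup.toAdelic (↥(maximalRealSubfield L)) L (IsCMField.complexConj L) 1 (JW (↥(maximalRealSubfield L)) L a)).range)) (_ : IsFiniteMeasure μW)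
            (_ : SMulInvariantMeasure ↥(UnitaryGroup.adelic (↥(maximalRealSubfield L)) L (IsCMField.complexConj L) 1 (JW (↥(maximalRealSubfield L)) L a)) (↥(UnitaryGroup.adelic (↥(maximalRealSubfield L)) L (IsCMField.complexConj L) 1 (JW (↥(maximalRealSubfield L)) L a)) ⧸ (UnitaryGroup.toAdelic (↥(maximalRealSubfield L)) L (IsCMField.complexConj L) 1 (JW (↥(maximalRealSubfield L)) L a)).range) μW)
            (Ψ : piSchwartzBruhat (↥(maximalRealSubfield L)) (Fin n'))
            (hθ : MemLp (toQuotFun (adelicGroupData (↥(maximalRealSubfield L)) L (IsCMField.complexConj L) N H) fun x =>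
              (lineThetaKernelDatum L N e₁ dV hdV hdV0 μ hμ a hρ).thetaLiftFun μW Ψ (charCM ξ) (ιA x)) 2 μA),
            v = MemLp.toLp _ hθ} : Set ((adelicGroupData (↥(maximalRealSubfield L)) L (IsCMField.complexConj L) N H).L2 μA)))
    (hpr : letI : MeasurableSpace (↥(UnitaryGroup.adelic (↥(maximalRealSubfield L)) L (IsCMField.complexConj L) 1 (JW (↥(maximalRealSubfield L)) L a)) ⧸
        (UnitaryGroup.toAdelic (↥(maximalRealSubfield L)) L (IsCMField.complexConj L) 1 (JW (↥(maximalRealSubfield L)) L a)).range) := borel _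
      haveI := normal_range_toAdelic_JW L a
      ∃ (hρ : HasThetaMajorants fun
          (p : ↥(UnitaryGroup.adelic (↥(maximalRealSubfield L)) L (IsCMField.complexConj L) N (Matrix.diagonal dV)) × ↥(UnitaryGroup.adelic (↥(maximalRealSubfield L)) L (IsCMField.complexConj L) 1 (JW (↥(maximalRealSubfield L)) L a))) (Φ : piSchwartzBruhat (↥(maximalRealSubfield L)) (Fin n')) =>
            pairRep (↥(maximalRealSubfield L)) L (IsCMField.complexConj L) N 1 e₁ (Matrix.diagonal dV) (JW (↥(maximalRealSubfield L)) L a)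
              (chiSplittingLine L e₁ dV hdV hdV0 (toHeckeCharacter L μ) (isUnitary_toHeckeCharacter L μ)
                ((isOscillatorChar_toHeckeCharacter_iff μ).mpr hμ) (TW (↥(maximalRealSubfield L)) a)
                (isUnit_det_TW (↥(maximalRealSubfield L)) a) (JW (↥(maximalRealSubfield L)) L a) (JW_eq (↥(maximalRealSubfield L)) L a))
              p Φ)
        (μW : Measure (↥(UnitaryGroup.adelic (↥(maximalRealSubfield L)) L (IsCMField.complexConj L) 1 (JW (↥(maximalRealSubfield L)) L a)) ⧸ (UnitaryGroup.toAdelic (↥(maximalRealSubfield L)) L (IsCMField.complexConj L) 1 (JW (↥(maximalRealSubfield L)) L a)).range))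
        (_ : IsFiniteMeasure μW)
        (_ : SMulInvariantMeasure ↥(UnitaryGroup.adelic (↥(maximalRealSubfield L)) L (IsCMField.complexConj L) 1 (JW (↥(maximalRealSubfield L)) L a)) (↥(UnitaryGroup.adelic (↥(maximalRealSubfield L)) L (IsCMField.complexConj L) 1 (JW (↥(maximalRealSubfield L)) L a)) ⧸ (UnitaryGroup.toAdelic (↥(maximalRealSubfield L)) L (IsCMField.complexConj L) 1 (JW (↥(maximalRealSubfield L)) L a)).range) μW)
        (f : C((↥(UnitaryGroup.adelic (↥(maximalRealSubfield L)) L (IsCMField.complexConj L) 1 (JW (↥(maximalRealSubfield L)) L a)) ⧸ (UnitaryGroup.toAdelic (↥(maximalRealSubfield L)) L (IsCMField.complexConj L) 1 (JW (↥(maximalRealSubfield L)) L a)).range), ℂ))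
        (Φ : piSchwartzBruhat (↥(maximalRealSubfield L)) (Fin n'))
        (hθ : MemLp (toQuotFun (adelicGroupData (↥(maximalRealSubfield L)) L (IsCMField.complexConj L) N H) fun x =>
          (lineThetaKernelDatum L N e₁ dV hdV hdV0 μ hμ a hρ).thetaLiftFun μW Φ f (ιA x)) 2 μA),
        P.space.toSubmodule.starProjection (MemLp.toLp _ hθ) ≠ 0) :
    MeetsThetaLiftFromLine L N H e₁ dV hdV hdV0 P μ hμ a ιA := by
  letI : MeasurableSpace (↥(UnitaryGroup.adelic (↥(maximalRealSubfield L)) L (IsCMField.complexConj L) 1 (JW (↥(maximalRealSubfield L)) L a)) ⧸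
      (UnitaryGroup.toAdelic (↥(maximalRealSubfield L)) L (IsCMField.complexConj L) 1 (JW (↥(maximalRealSubfield L)) L a)).range) := borel _
  haveI : BorelSpace (↥(UnitaryGroup.adelic (↥(maximalRealSubfield L)) L (IsCMField.complexConj L) 1 (JW (↥(maximalRealSubfield L)) L a)) ⧸
      (UnitaryGroup.toAdelic (↥(maximalRealSubfield L)) L (IsCMField.complexConj L) 1 (JW (↥(maximalRealSubfield L)) L a)).range) := ⟨rfl⟩
  haveI := normal_range_toAdelic_JW L a
  -- the pinned transport is continuous and carries rational points to rational points
  have hιA' : Continuous ιA ∧ ∀ ⦃γ : (adelicGroupData (↥(maximalRealSubfield L)) L (IsCMField.complexConj L) N H).Adelic⦄,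
      γ ∈ (UnitaryGroup.toAdelic (↥(maximalRealSubfield L)) L (IsCMField.complexConj L) N H).range →
        ιA γ ∈ (UnitaryGroup.toAdelic (↥(maximalRealSubfield L)) L (IsCMField.complexConj L) N (Matrix.diagonal dV)).range :=
    ⟨continuous_of_pin L N H dV g ιA hιA, fun _ hγ => mem_range_toAdelic_of_pin L N H dV t ht g hg ιA hιA hγ⟩
  obtain ⟨hρ, μW, hfinW, hinvW, f, Φ, hθ, hne⟩ := hpr
  haveI : IsFiniteMeasure μW := hfinW
  haveI := hinvW
  -- STEP 1: character detection through `pr_P` (the `MemLp` witness is proof-irrelevant: read it as the uniform one)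
  have hne' : P.space.toSubmodule.starProjection
      (MemLp.toLp _ (memLp_toQuotFun_lineThetaLift L N H e₁ dV hdV hdV0 ιA hιA' μ hμ a hρ μW Φ f μA 2)) ≠ 0 := hne
  obtain ⟨ξ, hξ⟩ := exists_charCM_of_apply_toLp_lineThetaLift_ne_zero L N H e₁ dV hdV hdV0 ιA hιA' μ hμ a hρ μW Φ f μA
    P.space.toSubmodule.starProjection hne'
  -- the detected character class `v`
  let v := MemLp.toLp _ (memLp_toQuotFun_lineThetaLift L N H e₁ dV hdV hdV0 ιA hιA' μ hμ a hρ μW Φ (charCM ξ) μA 2)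
  have hv : P.space.toSubmodule.starProjection v ≠ 0 := hξ
  have hv0 : v ≠ 0 := fun h0 => hv (by rw [h0, map_zero])
  -- STEP 2: the `(a, ξ)`-theta span `Q`, a closed invariant subspace containing `v`, irreducible
  obtain ⟨Q, hQmem, hQcar⟩ := exists_closedSubrep_thetaSpan L N H e₁ dV hdV hdV0 t ht g hg ιA hιA (μA := μA) μ hμ a ξ
  have hvQ : v ∈ Q.toSubmodule := hQmem hρ μW hfinW hinvW Φ _
  have hQirr : Q.toContRep.IsTopIrreducible := by
    rcases hIrr ξ Q hQcar with hbot | hirr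
    · exact absurd ((Submodule.mem_bot ℂ).1 (hbot ▸ hvQ)) hv0
    · exact hirr
  -- STEP 3 (no multiplicity one): by the realisation letter `P ⊆ Q̄ = Q`; `Q` irreducible and `P ≠ 0` closed invariant ⇒ `P = Q ∋ v`
  have hsub : (P.space.toSubmodule : Set ((adelicGroupData (↥(maximalRealSubfield L)) L (IsCMField.complexConj L) N H).L2 μA)) ⊆
      (Q.toSubmodule : Set ((adelicGroupData (↥(maximalRealSubfield L)) L (IsCMField.complexConj L) N H).L2 μA)) := by
    rw [hQcar]
    exact hReal ξ P ⟨hρ, μW, hfinW, hinvW, Φ, _, hv⟩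
  have hle : P.space ≤ Q := fun w hw => hsub hw
  have hPnt : Nontrivial P.space.toSubmodule := by
    exact ((ContRepresentation.isTopIrreducible_iff _).1 P.irreducible).1
  have hQP : P.space = Q := ContRepresentation.ClosedSubrep.eq_of_le_of_isTopIrreducible hQirr hPnt hle
  -- conclusion: the non-zero `(a, ξ)`-class `v` lies in `P`
  exact ⟨hρ, μW, hfinW, hinvW, charCM ξ, Φ, _, hQP ▸ hvQ, hv0⟩

end Summit.HodgeConjecture.HodgeConjecture.Cruxes.HLiu418.F0LD1MeetsOfRealises

end
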